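import Summits.BirchSwinnertonDyer.BirchSwinnertonDyer.Theorems.GenusKolyvaginAtTwoK4NegBetaFrameDeepPrimeTopBit
import Summits.BirchSwinnertonDyer.BirchSwinnertonDyer.Theorems.GenusKolyvaginAtTwoEquivariantChebotarevAtTwoOfChebotarev
import Summits.BirchSwinnertonDyer.BirchSwinnertonDyer.Theorems.GenusKolyvaginAtTwoGenusPrimitiveSupplyAtTwoTwistingPrimeInvolution
import Literature.NumberTheory.GaloisRepresentations.AbsGaloisOuterConj
import HarnessLib

/-!
# Route `GenusKolyvaginAtTwo`, crux K₄⁻ `K4Neg` (stmt-BirchSwinnertonDyer-31526), the (β)-residual F4ᶠ —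
# THE (β)-SUPPLY ONE LEVEL UP: deep `FrobEqFrobInfty` Kolyvagin primes that SEE the top bit exist beyond every bound

Width seat `bsd-line-gk2-p5` g43 (cell `bsd-f1-sign2`), WIDTH-5 attach on route `GenusKolyvaginAtTwo` rev 59, lane «the (β)-residual of K₄⁻».
`--supports stmt-BirchSwinnertonDyer-31526 --as helper`.  THEOREMS ONLY (no definition, no named fact, no `sorry`); standard axioms.
**BSD is NOT proved by this file; `K4Neg` is NOT proved; no item is closed by it.**

WHY.  The tree's Čebotarev supply of Kolyvagin primes at `2` (`EquivariantChebotarevAtTwoR`, item 27280, PROVED; McCallum Cor. 3.2 at `p = 2`) needs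
a family whose span contains NO phantom (`hres`).  On a (β)-frame the relevant class — the level-`4` Kummer class `κ₄` of the twin's generator — has
the Lawson–Wuthrich phantom as its double, so that supply is void there; files `…BetaFrameDeepPrimeOneBit/TopBit` (gk2-p5 g43, p792036/p792141) showed
that a deep Frobenius nevertheless sees exactly ONE bit of `κ₄` (the top bit) and that both bit values occur on the Galois side.  THIS FILE turns the
Galois-side statement into PRIMES: a Čebotarev supply for a class WITH a phantom in its span.

* §1 `exists_mem_conj_sq_smul_sub_ne` — the top-bit flip inside a prescribed conjugation-stable subgroup `H` (the form Čebotarev consumes; from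
  file 2's flip law and `Γ`-equivariance).
* §2 ★★★ `exists_deep_frobEqFrobInfty_prime_sq_smul_sub_ne` — **THE SUPPLY.**  `W/ℚ` globally minimal (the curve whose Kolyvagin primes are wanted),
  `V/ℚ` elliptic (the curve carrying the points; `V = W` or its twist), `K` imaginary quadratic, `c₀` a complex conjugation moving a point of `V[2]`;
  `R ∈ V(ℚ̄)^{Γ_ℚ}` with halves `Q' ∋` quarter `Q`; an open subgroup `H ≤ Γ_ℚ`, stable under conjugation, fixing `W[4]`, the points of `V` killed by
  `4`, the field `K` and the half `Q'` (on the frame: `H = Γ_{K(E[4])}`, and «`H` fixes `Q'`» IS the (β) entanglement), some element of which moves `Q`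
  (file 3 `OneBitDescent`: automatic for a non-halvable `K`-point), and no non-zero `2`-torsion point of `V` fixed by `Γ_ℚ`.  THEN for every bound `b`
  there is a prime `ℓ > b` with **`ℓ ∤ N`, `ℓ ∤ d_K`, `ℓ ≠ 2`, `(ℓ)` prime in `𝓞_K`, `FrobEqFrobInfty W K 4 ℓ`, `4 ∣ ℓ + 1`, `4 ∣ a_ℓ(W)`** — a deep
  Kolyvagin prime of K4Neg's witness type — and an arithmetic Frobenius `h` at `ℓ` acting on `W[4]` as `c₀` with **`h·h·Q − Q ≠ 0`**: the localisation
  at `λ = ℓ𝓞_K` of the level-`4` Kummer class of `R` (root `Q`) is the NON-ZERO bit.  (Čebotarev in the open set `c₀γ·(H ∩ Stab Q ∩ Stab(c₀γQ))`,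
  `γ ∈ H` from §1; inertness and the congruences as in the tree's `exists_kolyvaginPrime_gt_two_tauStable`, Steps E–H.)

READING (census of the (β) residual; nothing closed).  This is the honest (β)-analogue, one level up, of gk2-p3 g34's (α)-supply
`exists_alive_primeFrame_of_phantom_selmer`: on a (β)-frame the first Kolyvagin step at level `2^{M₀+1}` is blind at EVERY deep prime, but at level
`2^{M₀+2}` (base class `ι κ₄(P_d)`) it is alive at the primes supplied here, giving derived classes `c(ℓ) ≠ 0` with `v₂(P(ℓ)) ≤ M₀ + 1` — non-degenerate,
not yet primitive.  What a two-prime / rigidity mechanism for F4ᶠ would consume is exactly this supply.  BSD is NOT proved by any of this.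

References: [McCallumLMS1991] §3 Prop. 3.1, Cor. 3.2; [GrossLMS1991] §3 (3.1)–(3.3), §9 Prop. 9.6; [MazurRubin2010] Lemma 3.5; [LawsonWuthrich2016] §3, §7.1;
[SilvermanAEC2009] VII.4.1, VIII.§2.
-/

set_option linter.dupNamespace false -- `Summit.<P>.<Sub>` repeats `BirchSwinnertonDyer` (D-0017)
set_option autoImplicit false

noncomputable section

open scoped Classical Pointwise

namespace Summit.BirchSwinnertonDyer.BirchSwinnertonDyer.Theorems.GenusExact.Lw2PhantomExclusion.DeepPrimeOneBit

open WeierstrassCurve Field NumberField IsDedekindDomain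
open Literature.NumberTheory.GaloisRepresentations Literature.NumberTheory.EllipticCurves
open Literature.NumberTheory
open Rat.HeightOneSpectrum
open Summit.BirchSwinnertonDyer.BirchSwinnertonDyer.Theorems.GenusKolyTwistingPrime

universe u

/-! ## §1 The top-bit flip inside a conjugation-stable subgroup -/

/-- **Top-bit flip inside `H`.**  Plus-case data of the one-bit law on `V` (`g·g = 1` on the points killed by `4`, `g` moves a `2`-torsion point,
`R` fixed by `Γ_ℚ`, `2Q' = R`, `2Q = Q'`) and a subgroup `H ≤ Γ_ℚ` stable under conjugation whose elements fix the points killed by `4` and `Q'`.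
If some element of `H` moves `Q` and no non-zero `2`-torsion point of `V` is `Γ_ℚ`-fixed, then some `γ ∈ H` has `(gγ)·(gγ)·Q − Q ≠ g·g·Q − Q`.
[cite: GrossLMS1991, §9 Prop. 9.1, 9.6] [cite: MazurRubin2010, Lemma 3.5] -/
theorem exists_mem_conj_sq_smul_sub_ne {V : WeierstrassCurve ℚ} [V.IsElliptic] {g : absoluteGaloisGroup ℚ}
    (hg4 : ∀ P : geomPoints V, (4 : ℤ) • P = 0 → g • g • P = P)
    (hge : ∃ e : geomPoints V, (2 : ℤ) • e = 0 ∧ g • e ≠ e)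
    {R Q' Q : geomPoints V} (hR : ∀ σ : absoluteGaloisGroup ℚ, σ • R = R) (hQ' : (2 : ℤ) • Q' = R) (hQ : (2 : ℤ) • Q = Q')
    {H : Subgroup (absoluteGaloisGroup ℚ)} (hH4 : ∀ γ ∈ H, ∀ P : geomPoints V, (4 : ℤ) • P = 0 → γ • P = P)
    (hHQ' : ∀ γ ∈ H, γ • Q' = Q') (hHn : ∀ (σ : absoluteGaloisGroup ℚ), ∀ γ ∈ H, σ * γ * σ⁻¹ ∈ H)
    (hN : ∃ γ₀ ∈ H, γ₀ • Q ≠ Q)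
    (hirr : ∀ m : geomPoints V, (2 : ℤ) • m = 0 → m ≠ 0 → ∃ σ : absoluteGaloisGroup ℚ, σ • m ≠ m) :
    ∃ γ ∈ H, (g * γ) • (g * γ) • Q - Q ≠ g • g • Q - Q := by
  obtain ⟨e, he, hge⟩ := hge
  obtain ⟨γ₀, hγ₀H, hγ₀Q⟩ := hN
  have hgg : ∀ P : geomPoints V, (2 : ℤ) • P = 0 → g • g • P = P := fun P hP ↦
    hg4 P (by rw [show (4 : ℤ) = 2 * 2 by norm_num, mul_smul, hP, smul_zero])
  have he₀2 : (2 : ℤ) • (γ₀ • Q - Q) = 0 := two_zsmul_smul_sub_eq_zero V hQ (hHQ' γ₀ hγ₀H)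
  have he₀0 : γ₀ • Q - Q ≠ 0 := fun h ↦ hγ₀Q (sub_eq_zero.mp h)
  by_cases hfix : g • (γ₀ • Q - Q) = γ₀ • Q - Q
  · obtain ⟨σ, hσe⟩ := hirr _ he₀2 he₀0
    obtain ⟨hγ4, hγQ', hγQ⟩ := conj_smul_sub_eq V (hH4 γ₀ hγ₀H) hQ' hQ (hHQ' γ₀ hγ₀H) (hR σ)
    refine ⟨σ * γ₀ * σ⁻¹, hHn σ γ₀ hγ₀H, fun h ↦ ?_⟩
    rw [conj_sq_smul_sub_eq_iff_of_smul_eq_self V hg4 hγ4 (hR g) hQ' hQ hγQ', hγQ] at h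
    have hσe2 : (2 : ℤ) • (σ • (γ₀ • Q - Q)) = 0 := by rw [smul_comm, he₀2, smul_zero]
    have hσe0 : σ • (γ₀ • Q - Q) ≠ 0 := fun h0 ↦ he₀0 (by
      have := congrArg (fun P ↦ σ⁻¹ • P) h0
      simpa only [inv_smul_smul, smul_zero] using this)
    have h1 := two_torsion_fixed_eq_zero_or_eq_add V hgg he hge hσe2 h
    have h2 := two_torsion_fixed_eq_zero_or_eq_add V hgg he hge he₀2 hfix
    rcases h1 with h1 | h1
    · exact hσe0 h1
    rcases h2 with h2 | h2
    · exact he₀0 h2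
    exact hσe (by rw [h1, ← h2])
  · exact ⟨γ₀, hγ₀H, fun h ↦
      hfix ((conj_sq_smul_sub_eq_iff_of_smul_eq_self V hg4 (hH4 γ₀ hγ₀H) (hR g) hQ' hQ (hHQ' γ₀ hγ₀H)).mp h)⟩

/-! ## §2 ★★★ The supply: deep `FrobEqFrobInfty` Kolyvagin primes seeing the top bit -/

/-- ★★★ **THE (β)-SUPPLY ONE LEVEL UP.**  `W/ℚ` globally minimal, `V/ℚ` elliptic, `K` imaginary quadratic, `N ≥ 1`; `c₀ ∈ Γ_ℚ` a complex conjugation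
moving a point of `V(ℚ̄)` killed by `2`; `R ∈ V(ℚ̄)` fixed by `Γ_ℚ`, `2Q' = R`, `2Q = Q'`; `H ≤ Γ_ℚ` OPEN and conjugation-stable, every element of which
fixes `W[4]`, the points of `V(ℚ̄)` killed by `4`, the field `K ⊂ ℚ̄` pointwise and the half `Q'`; some element of `H` moves `Q`; no non-zero point of `V(ℚ̄)`
killed by `2` is `Γ_ℚ`-fixed.  Then for every `b` there is a prime `ℓ > b` with `ℓ ∤ N`, `ℓ ∤ d_K`, `ℓ ≠ 2`, `(ℓ)` prime in `𝓞 K`,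
`FrobEqFrobInfty W K 4 ℓ`, `4 ∣ ℓ + 1`, `4 ∣ a_ℓ(W)` (a DEEP Kolyvagin prime of K4Neg's witness type), and an arithmetic Frobenius `h` at `ℓ` acting
on `W[4]` as `c₀` with **`h·h·Q − Q ≠ 0`** — the top bit of the level-`4` Kummer class of `R` (root `Q`) is the VISIBLE bit at `λ = ℓ𝓞_K`.
Proof: §1 with `g = c₀` (`c₀² = 1`) gives `γ ∈ H` with `(c₀γ)²Q ≠ Q`; Čebotarev (`frobenius_dense`) in the open set `c₀γ·(H ∩ Stab Q ∩ Stab(c₀γQ))`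
away from the primes of `2 N d_K`, the primes `≤ b`, the places ramified in `K` and the bad places of `W` gives `h = c₀γn` with `h·h·Q = (c₀γ)²Q`;
`h ∉ Γ_K` makes `ℓ` inert (`exists_place_inert_of_not_mem_range`); `h = c₀` on `W[4]` and on `K` is `FrobEqFrobInfty W K 4 ℓ`, whence
`4 ∣ ℓ + 1`, `4 ∣ a_ℓ` (`pow_dvd_add_one_of_frobEqFrobInfty`, `pow_dvd_frobeniusTraceAt_of_frobEqFrobInfty`).
[cite: McCallumLMS1991, §3 Prop. 3.1, Cor. 3.2] [cite: GrossLMS1991, §3 (3.2)–(3.3)] [cite: MazurRubin2010, Lemma 3.5] -/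
theorem exists_deep_frobEqFrobInfty_prime_sq_smul_sub_ne
    (W : WeierstrassCurve ℚ) [W.IsElliptic] [W.IsGloballyMinimal] (V : WeierstrassCurve ℚ) [V.IsElliptic]
    {K : Type} [Field K] [NumberField K] (hK : IsImaginaryQuadratic K) (N : ℕ) [NeZero N]
    {c₀ : absoluteGaloisGroup ℚ} (hc₀ : IsComplexConjugation (Rat.castHom ℝ) c₀)
    (hce : ∃ e : geomPoints V, (2 : ℤ) • e = 0 ∧ c₀ • e ≠ e)
    {R Q' Q : geomPoints V} (hR : ∀ σ : absoluteGaloisGroup ℚ, σ • R = R) (hQ' : (2 : ℤ) • Q' = R) (hQ : (2 : ℤ) • Q = Q')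
    {H : Subgroup (absoluteGaloisGroup ℚ)} (hHopen : IsOpen (H : Set (absoluteGaloisGroup ℚ)))
    (hHn : ∀ (σ : absoluteGaloisGroup ℚ), ∀ γ ∈ H, σ * γ * σ⁻¹ ∈ H)
    (hHW : ∀ γ ∈ H, ∀ P : geomTorsion W ((2 ^ 2 : ℕ) : ℤ), γ • P = P)
    (hHV : ∀ γ ∈ H, ∀ P : geomPoints V, (4 : ℤ) • P = 0 → γ • P = P)
    (hHK : ∀ γ ∈ H, ∀ x : K, γ • absEmbedding ℚ K x = absEmbedding ℚ K x)
    (hHQ' : ∀ γ ∈ H, γ • Q' = Q') (hN : ∃ γ₀ ∈ H, γ₀ • Q ≠ Q)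
    (hirr : ∀ m : geomPoints V, (2 : ℤ) • m = 0 → m ≠ 0 → ∃ σ : absoluteGaloisGroup ℚ, σ • m ≠ m) (b : ℕ) :
    ∃ ℓ : ℕ, b < ℓ ∧ ℓ.Prime ∧ ¬ ℓ ∣ N ∧ ¬ ((ℓ : ℤ) ∣ NumberField.discr K) ∧ ℓ ≠ 2 ∧
      (Ideal.span {(ℓ : 𝓞 K)}).IsPrime ∧ FrobEqFrobInfty W K (2 ^ 2) ℓ ∧ 2 ^ 2 ∣ ℓ + 1 ∧ ((2 : ℤ) ^ 2) ∣ W.frobeniusTrace ℓ ∧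
      ∃ (v : HeightOneSpectrum (𝓞 ℚ)) (𝔓 : Ideal (absIntegers (𝓞 ℚ) ℚ)) (h : absoluteGaloisGroup ℚ),
        (ℓ : 𝓞 ℚ) ∈ v.asIdeal ∧ 𝔓 ∈ v.primesAbove ∧ IsArithFrobAt (𝓞 ℚ) h 𝔓 ∧
        (∀ P : geomTorsion W ((2 ^ 2 : ℕ) : ℤ), h • P = c₀ • P) ∧ h • h • Q - Q ≠ 0 := by
  classical
  have hp : Nat.Prime 2 := Nat.prime_two
  haveI : Fact (Nat.Prime 2) := ⟨hp⟩
  haveI : Algebra.IsQuadraticExtension ℚ K := ⟨hK.1⟩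
  haveI : IsTotallyComplex K := hK.2
  -- ### Step A: `c₀` is an involution, so `c₀·c₀` fixes everything
  have hc1 : c₀ * c₀ = 1 := by rw [← sq]; exact hc₀.sq_eq_one
  have hg4 : ∀ P : geomPoints V, (4 : ℤ) • P = 0 → c₀ • c₀ • P = P := fun P _ ↦ by rw [← mul_smul, hc1, one_smul]
  -- ### Step B: the flip inside `H`
  obtain ⟨γ, hγH, hflip⟩ := exists_mem_conj_sq_smul_sub_ne hg4 hce hR hQ' hQ hHV hHQ' hHn hN hirr
  have hγγ : (c₀ * γ) • (c₀ * γ) • Q - Q ≠ 0 := by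
    intro h0
    apply hflip
    rw [h0, ← mul_smul, hc1, one_smul, sub_self]
  -- ### Step C: the finite exceptional set of places of `ℚ`
  have hbad₀ : (W.badPlaces (𝓞 ℚ)).Finite := W.finite_badPlaces_holds (𝓞 ℚ)
  set B : Finset ℕ := {2} ∪ N.primeFactors ∪ (NumberField.discr K).natAbs.primeFactors ∪ Finset.range (b + 1) with hB
  set S₁ : Set (HeightOneSpectrum (𝓞 ℚ)) := {v | ∃ q ∈ B, q.Prime ∧ (q : 𝓞 ℚ) ∈ v.asIdeal} with hS₁
  set S₂ : Set (HeightOneSpectrum (𝓞 ℚ)) := {v | ¬ Algebra.IsUnramifiedIn (𝓞 K) v.asIdeal} with hS₂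
  have hS₁fin : S₁.Finite := by
    have : S₁ ⊆ ⋃ q ∈ (B.filter Nat.Prime), {v | (q : 𝓞 ℚ) ∈ v.asIdeal} := by
      intro v ⟨q, hqB, hq, hqv⟩
      simp only [Set.mem_iUnion, Finset.mem_filter]
      exact ⟨q, ⟨hqB, hq⟩, hqv⟩
    refine Set.Finite.subset (Set.Finite.biUnion (Finset.finite_toSet _) fun q hq ↦ ?_) this
    rw [Finset.coe_filter, Set.mem_setOf_eq] at hq
    have hsub : {v : HeightOneSpectrum (𝓞 ℚ) | (q : 𝓞 ℚ) ∈ v.asIdeal}.Subsingleton :=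
      fun v hv v' hv' ↦ HeightOneSpectrum.eq_of_natCast_mem_rat hq.2 hv hv'
    exact hsub.finite
  have hS₂fin : S₂.Finite := finite_setOf_not_isUnramifiedIn ℚ K
  set S := S₁ ∪ S₂ ∪ W.badPlaces (𝓞 ℚ) with hSdef
  have hSfin : S.Finite := (hS₁fin.union hS₂fin).union hbad₀
  -- ### Step D: Čebotarev in `Γ_ℚ`: a Frobenius in the open set `c₀γ · (H ∩ Stab Q ∩ Stab (c₀γ·Q))`
  set A₁ : Subgroup (absoluteGaloisGroup ℚ) := MulAction.stabilizer (absoluteGaloisGroup ℚ) Q with hA₁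
  set A₂ : Subgroup (absoluteGaloisGroup ℚ) := MulAction.stabilizer (absoluteGaloisGroup ℚ) ((c₀ * γ) • Q) with hA₂
  have hA₁open : IsOpen (A₁ : Set (absoluteGaloisGroup ℚ)) := V.isOpen_stabilizer_point_holds Q
  have hA₂open : IsOpen (A₂ : Set (absoluteGaloisGroup ℚ)) := V.isOpen_stabilizer_point_holds ((c₀ * γ) • Q)
  set U : Set (absoluteGaloisGroup ℚ) := ((H : Set _) ∩ (A₁ : Set _)) ∩ (A₂ : Set _) with hU
  have hUopen : IsOpen U := (hHopen.inter hA₁open).inter hA₂open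
  set O : Set (absoluteGaloisGroup ℚ) := (fun n ↦ c₀ * γ * n) '' U with hO
  have hOopen : IsOpen O := (Homeomorph.mulLeft (c₀ * γ)).isOpenMap _ hUopen
  have hOne : O.Nonempty := ⟨c₀ * γ * 1, 1, ⟨⟨H.one_mem, A₁.one_mem⟩, A₂.one_mem⟩, rfl⟩
  obtain ⟨h, hhO, v, hvS, 𝔓₀, h𝔓₀, hh⟩ :=
    (absoluteGaloisGroup.frobenius_dense Automorphic.chebotarev_artinRep_holds ℚ S hSfin).inter_open_nonempty O hOopen hOne
  obtain ⟨n, ⟨⟨hnH, hnA₁⟩, hnA₂⟩, rfl⟩ := hhO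
  have hnQ : n • Q = Q := hnA₁
  have hnQ₁ : n • ((c₀ * γ) • Q) = (c₀ * γ) • Q := hnA₂
  -- the point identity `h·h·Q = (c₀γ)·(c₀γ)·Q`
  have hhhQ : (c₀ * γ * n) • (c₀ * γ * n) • Q = (c₀ * γ) • (c₀ * γ) • Q := by
    rw [mul_smul (c₀ * γ) n, mul_smul (c₀ * γ) n, hnQ, hnQ₁]
  -- `γ n ∈ H` fixes `W[4]` and `K`
  have hγn : γ * n ∈ H := mul_mem hγH hnH
  have hrK : γ * n ∈ (absGaloisRestrict ℚ K).range :=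
    (mem_range_absGaloisRestrict_iff_smul_absEmbedding (F := ℚ) (M := K) (γ * n)).mpr (hHK _ hγn)
  obtain ⟨g', hg'⟩ := hrK
  -- ### Step E: the rational prime `ℓ` under `v`
  obtain ⟨ℓ, hℓ, hℓv⟩ := exists_prime_natCast_mem v
  have hℓB : ℓ ∉ B := fun hmem ↦ hvS (Or.inl (Or.inl ⟨ℓ, hmem, hℓ, hℓv⟩))
  simp only [hB, Finset.mem_union, Finset.mem_singleton, Nat.mem_primeFactors, Finset.mem_range, not_or] at hℓB
  obtain ⟨⟨⟨hℓp, hℓN⟩, hℓD⟩, hℓb⟩ := hℓB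
  have hℓN' : ¬ ℓ ∣ N := fun hd ↦ hℓN ⟨hℓ, hd, NeZero.ne N⟩
  have hℓD' : ¬ ((ℓ : ℤ) ∣ NumberField.discr K) := fun hd ↦
    hℓD ⟨hℓ, Int.natAbs_dvd_natAbs.mpr hd |>.trans (by simp), by simp [NumberField.discr_ne_zero]⟩
  have hbℓ : b < ℓ := by omega
  have hunr : Algebra.IsUnramifiedIn (𝓞 K) v.asIdeal := by
    by_contra hcon; exact hvS (Or.inl (Or.inr hcon))
  have hgood₀ : W.HasGoodReductionAt v := by
    by_contra hcon; exact hvS (Or.inr hcon)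
  -- ### Step F: `ℓ` is inert in `K`
  have hHi := index_range_absGaloisRestrict_eq_finrank ℚ K
  haveI hRn : ((absGaloisRestrict ℚ K).range).Normal := Subgroup.normal_of_index_eq_two (hHi.trans hK.1)
  have hI := inertia_le_range_absGaloisRestrict_of_isUnramifiedIn (K := K) hunr h𝔓₀
  have hΦH : c₀ * γ * n ∉ (absGaloisRestrict ℚ K).range := by
    intro hmem
    apply hc₀.not_mem_range_absGaloisRestrict (L := K) IsTotallyComplex.isComplex
    change c₀ ∈ ((absGaloisRestrict ℚ K).range : Set (absoluteGaloisGroup ℚ))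
    have h' : c₀ = c₀ * γ * n * (γ * n)⁻¹ := by group
    rw [SetLike.mem_coe, h']
    exact Subgroup.mul_mem _ hmem (Subgroup.inv_mem _ ⟨g', hg'⟩)
  obtain ⟨w, 𝔔, τ', hwv, hwuniq, -, h𝔔w, -, -, -⟩ :=
    exists_place_inert_of_not_mem_range (F := ℚ) (M := K) (hK.1 ▸ Nat.prime_two) hRn (hHi.trans rfl) hunr h𝔓₀ hI hh hΦH
  have hℓw : (ℓ : 𝓞 K) ∈ w.asIdeal := by
    have h1 : (ℓ : 𝓞 ℚ) ∈ (w.under (𝓞 ℚ)).asIdeal := by rw [hwv]; exact hℓv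
    rw [HeightOneSpectrum.under_asIdeal, Ideal.under_def, Ideal.mem_comap, map_natCast] at h1
    exact h1
  have hwuniq' : ∀ w' : HeightOneSpectrum (𝓞 K), (ℓ : 𝓞 K) ∈ w'.asIdeal → w' = w := by
    intro w' hw'
    apply hwuniq
    apply HeightOneSpectrum.eq_of_natCast_mem_rat hℓ _ hℓv
    rw [HeightOneSpectrum.under_asIdeal, Ideal.under_def, Ideal.mem_comap, map_natCast]
    exact hw'
  have hspan : Ideal.span {(ℓ : 𝓞 K)} = w.asIdeal := by
    apply span_natCast_eq_of_unique hℓ w hwuniq'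
    haveI : w.asIdeal.LiesOver v.asIdeal := ⟨by rw [← hwv]; rfl⟩
    have hmap : v.asIdeal.map (algebraMap (𝓞 ℚ) (𝓞 K)) = Ideal.span {(ℓ : 𝓞 K)} := by
      rw [← span_natCast_rat_eq hℓ hℓv, Ideal.map_span, Set.image_singleton, map_natCast]
    have hne : v.asIdeal.map (algebraMap (𝓞 ℚ) (𝓞 K)) ≠ ⊥ := by
      rw [hmap, Ne, Ideal.span_singleton_eq_bot]; exact_mod_cast hℓ.ne_zero
    rw [← hmap, ← Ideal.IsDedekindDomain.ramificationIdx_eq_normalizedFactors_count v.asIdeal w.asIdeal hne]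
    exact Ideal.ramificationIdx_eq_one_iff.mpr (hunr w.asIdeal w.isPrime inferInstance)
  -- ### Step G: `h` acts on `W[4]` and on `K` as `c₀`: `FrobEqFrobInfty W K 4 ℓ`
  have hFE : ∀ P : geomTorsion W ((2 ^ 2 : ℕ) : ℤ), (c₀ * γ * n) • P = c₀ • P := fun P ↦ by
    rw [mul_assoc, mul_smul, hHW _ hγn P]
  have h32 : FrobEqFrobInfty W K (2 ^ 2) ℓ := by
    refine ⟨v, 𝔓₀, c₀ * γ * n, c₀, hℓv, h𝔓₀, hh, hc₀, fun P ↦ ?_, fun e x ↦ ?_⟩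
    · exact_mod_cast hFE P
    · have hg'' : absGaloisRestrict ℚ K g' = γ * n := hg'
      rw [mul_assoc, mul_smul, ← hg'', absGaloisRestrict_smul_apply_eq g' e x]
  -- ### Step H: the congruences, and assembly
  have hℓ2 : ℓ ≠ 2 := hℓp
  have hM : 1 ≤ 2 := by norm_num
  have hdvd1 : 2 ^ 2 ∣ ℓ + 1 := pow_dvd_add_one_of_frobEqFrobInfty W (K := K) hp hM hℓ hℓ2 h32
  have hdvd2 : ((2 : ℤ) ^ 2) ∣ W.frobeniusTrace ℓ := by
    have hd := pow_dvd_frobeniusTraceAt_of_frobEqFrobInfty W (K := K) hp hM hℓ hℓ2 h32 hℓv hgood₀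
    rw [frobeniusTraceAt_eq_frobeniusTrace W v] at hd
    rwa [show ((primesEquiv v : ℕ)) = ℓ from primesEquiv_eq_of_natCast_mem hℓ hℓv] at hd
  refine ⟨ℓ, hbℓ, hℓ, hℓN', hℓD', hℓ2, hspan ▸ w.isPrime, h32, hdvd1, hdvd2, v, 𝔓₀, c₀ * γ * n, hℓv, h𝔓₀, hh, hFE, ?_⟩
  rw [hhhQ]
  exact hγγ

/-- ★★★ **THE SUPPLY IN K4Neg's WITNESS-PRIME CURRENCY**: under the hypotheses of `exists_deep_frobEqFrobInfty_prime_sq_smul_sub_ne` with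
`N := W.conductorNorm ℤ`, for every bound there is a prime `ℓ` beyond it with
`Zhang2014.IsKolyvaginPrime (W.conductorNorm ℤ) W K 2 ℓ ∧ 2 ≤ Zhang2014.kolyvaginIndex W 2 ℓ ∧ FrobEqFrobInfty W K 4 ℓ` (so also `Frob_ℓ = Frob_∞` on
`K(E[2])`) and a Frobenius `h` at `ℓ` with `h·h·Q − Q ≠ 0`.  BSD / `K4Neg` NOT proved by this. [cite: WZhang2014, Notations (xii)]
[cite: GrossLMS1991, §3 (3.2)–(3.3)] [cite: McCallumLMS1991, §3 Cor. 3.2] -/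
theorem exists_kolyvaginPrime_deep_sq_smul_sub_ne
    (W : WeierstrassCurve ℚ) [W.IsElliptic] [W.IsGloballyMinimal] [NeZero (W.conductorNorm ℤ)] (V : WeierstrassCurve ℚ) [V.IsElliptic]
    {K : Type} [Field K] [NumberField K] (hK : IsImaginaryQuadratic K)
    {c₀ : absoluteGaloisGroup ℚ} (hc₀ : IsComplexConjugation (Rat.castHom ℝ) c₀)
    (hce : ∃ e : geomPoints V, (2 : ℤ) • e = 0 ∧ c₀ • e ≠ e)
    {R Q' Q : geomPoints V} (hR : ∀ σ : absoluteGaloisGroup ℚ, σ • R = R) (hQ' : (2 : ℤ) • Q' = R) (hQ : (2 : ℤ) • Q = Q')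
    {H : Subgroup (absoluteGaloisGroup ℚ)} (hHopen : IsOpen (H : Set (absoluteGaloisGroup ℚ)))
    (hHn : ∀ (σ : absoluteGaloisGroup ℚ), ∀ γ ∈ H, σ * γ * σ⁻¹ ∈ H)
    (hHW : ∀ γ ∈ H, ∀ P : geomTorsion W ((2 ^ 2 : ℕ) : ℤ), γ • P = P)
    (hHV : ∀ γ ∈ H, ∀ P : geomPoints V, (4 : ℤ) • P = 0 → γ • P = P)
    (hHK : ∀ γ ∈ H, ∀ x : K, γ • absEmbedding ℚ K x = absEmbedding ℚ K x)
    (hHQ' : ∀ γ ∈ H, γ • Q' = Q') (hN : ∃ γ₀ ∈ H, γ₀ • Q ≠ Q)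
    (hirr : ∀ m : geomPoints V, (2 : ℤ) • m = 0 → m ≠ 0 → ∃ σ : absoluteGaloisGroup ℚ, σ • m ≠ m) (b : ℕ) :
    ∃ ℓ : ℕ, b < ℓ ∧ Zhang2014.IsKolyvaginPrime (W.conductorNorm ℤ) W K 2 ℓ ∧ 2 ≤ Zhang2014.kolyvaginIndex W 2 ℓ ∧
      FrobEqFrobInfty W K (2 ^ 2) ℓ ∧
      ∃ (v : HeightOneSpectrum (𝓞 ℚ)) (𝔓 : Ideal (absIntegers (𝓞 ℚ) ℚ)) (h : absoluteGaloisGroup ℚ),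
        (ℓ : 𝓞 ℚ) ∈ v.asIdeal ∧ 𝔓 ∈ v.primesAbove ∧ IsArithFrobAt (𝓞 ℚ) h 𝔓 ∧
        (∀ P : geomTorsion W ((2 ^ 2 : ℕ) : ℤ), h • P = c₀ • P) ∧ h • h • Q - Q ≠ 0 := by
  haveI : Fact (Nat.Prime 2) := ⟨Nat.prime_two⟩
  obtain ⟨ℓ, hbℓ, hℓ, hℓN, hℓD, hℓ2, hprime, h32, hdvd1, hdvd2, hrest⟩ :=
    exists_deep_frobEqFrobInfty_prime_sq_smul_sub_ne W V hK (W.conductorNorm ℤ) hc₀ hce hR hQ' hQ hHopen hHn hHW hHV hHK hHQ' hN hirr b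
  have hidx : 2 ≤ Zhang2014.kolyvaginIndex W 2 ℓ :=
    (Zhang2014.le_kolyvaginIndex_iff (W := W) (p := 2) (M := 2) (ℓ := ℓ)).mpr ⟨hdvd1, by exact_mod_cast hdvd2⟩
  exact ⟨ℓ, hbℓ, ⟨hℓ, hℓN, hℓD, hℓ2, hprime, lt_of_lt_of_le (by norm_num) hidx⟩, hidx, h32, hrest⟩

end Summit.BirchSwinnertonDyer.BirchSwinnertonDyer.Theorems.GenusExact.Lw2PhantomExclusion.DeepPrimeOneBit

end
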